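import Mathlib
import HarnessLib
import Literature.MathematicalPhysics.QuantumFieldTheory.OSSectorContinuation
import Literature.MathematicalPhysics.QuantumFieldTheory.OSReconstructionNoE1Proofs
import Summits.QuantumFields.YangMills.Theorems.MirrorModularBoostsPlanarSpectralConeFrontEnd
import Literature.MathematicalPhysics.QuantumFieldTheory.OSHolomorphicVectors
import Summits.QuantumFields.YangMills.Theorems.MirrorModularBoostsPlanarSpectralConeOneGapSector
import Summits.QuantumFields.YangMills.Theorems.MirrorModularBoostsPlanarSpectralConeDiscSections
import Summits.QuantumFields.YangMills.Theorems.MirrorModularBoostsPlanarSpectralConeDensityOfParts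
import Summits.QuantumFields.YangMills.Theorems.MirrorModularBoostsPlanarSpectralConeWindowedDensity
import Summits.QuantumFields.YangMills.Theorems.MirrorModularBoostsPlanarSpectralConeTransfer
import Summits.QuantumFields.YangMills.Theorems.MirrorModularBoostsPlanarSpectralConeDelayedLever
import Summits.QuantumFields.YangMills.Theorems.MirrorModularBoostsPlanarSpectralConeSpanLinearity

/-!
PROVENANCE.  Strategist-written candidate proof (planner-cstrat-stmt-QuantumFields-9910-r1-0, 2026-08-17; tree copy
`Summits/QuantumFields/QCD/Cruxes/LabelledPlanarSpectralCone/Proof.lean`, 1499 lines, lean check rc 0 / 0 sorries / 0 warnings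
against the tree of 2026-08-28), landed VERBATIM in ≤ 400-line parts under `Theorems/` by width seat ym-t4-w17 g0 (free hands):
parts `…LabelledConeDiscSections` (X₁), `…LabelledConeChainDensity{Kinematics,Sector,OneGap,}` (X₂), `…LabelledPlanarSpectralConeSplit`
(glue), and the by-name closers `…Holds`.  Statements are INLINE (no route import), so these parts are route-independent.
-/
/-!
# `LabelledPlanarSpectralCone` — the crux-strategist's SPLIT (support for stmt-QuantumFields-9910)

Crux `stmt-QuantumFields-9910` (`TransparentRPWall.LabelledPlanarSpectralCone`, sub `QCD`): the
labelled planar spectral cone — for a labelled Schwinger family `S` over ANY label type `ι` on `ℝ⁴`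
with E0', E3, translations on `⁰𝒮` and reflection positivity in pull-back form for the eight frames of
the `(x₀,x₁)`-plane, the two-variable matrix elements `(t,b) ↦ 𝔖_{n+m}^{rev k ++ k'}(ΘF* ⊗ G_{te₀+be₁})`
extend to holomorphic contraction families on `{|Im β| < Re ζ}`, i.e. `spec(H,P₁) ⊂ {E ≥ |p₁|}` on the
OS space of all species. Its one-species case `MirrorModularBoosts.PlanarSpectralCone`
(stmt-QuantumFields-9664, sub `YangMills`) is PROVED in the tree (`PlanarSpectralCone_of`, line
`positivity-disc-to-operator-cone`, `Theorems/MirrorModularBoostsPlanarSpectralCone*.lean`).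

This file is the labelled twin of that line's kernel-checked TOP CUT. Of the line's five stubs, three
are already landed in LABEL-GENERIC form and are used here by name —

* `stub_linearity` (SpanLinearity: null sets of joint spectral measures pass to the closed span; any
  labels, any dimension),
* `stub_cone_of_discSections` (DelayedLever: the measure-theoretic lever, disc sections with a
  `t`-uniform bound ⇒ the measure charges nothing outside the closed cone),
* `Contraction.contractionFamily` (Transfer: the abstract holomorphic contraction family on the
  operator cone, stated for `OSReconstructionNoE1 T` with `T` any labelled family) —

while the two stubs whose landed proofs are written for ONE species (`fun _ => ()` labels) become
the two pieces of the split, re-typed with label strings: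

* `X₁` = **LabelledConeDiscSections** (FRONT END): translations on `⁰𝒮` + eight-frame pull-back RP
  ⇒ for every cone-chain field vector `Ψ = Ψ_G^{k}` of the `e₀` OS space the diagonal matrix element
  `b ↦ ⟪Ψ, e^{-tH} U(b e₁) Ψ⟫` has, for every `t > c`, a holomorphic extension to the disc of radius
  `t − c` bounded by ONE constant `M` (port of FrontEnd/ConeChainFrames/DiscSections with labels);
* `X₂` = **LabelledConeChainDensity** (DENSITY): in the `e₀` OS space of any labelled family the
  cone-chain field vectors (all arities, all label strings) span a dense subspace (port of
  DensityOfParts/DensityHelpers/OneGap*; `stub_windowedDensity` is label-free and landed).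

`LabelledPlanarSpectralCone_of_subs : X₁ → X₂ → LabelledPlanarSpectralCone`, sorry-free, ~70 lines of
glue: the `e₀`-frame reconstruction `h : OSReconstructionNoE1 S` exists under the crux hypotheses
(E2 = the frame `R = 1`, `a = 1`, `b = 0`; translations relabelled); `stub_linearity` reduces cone
support of every joint spectral measure to the cone-chain vectors (`X₂`), for which `X₁` feeds
`stub_cone_of_discSections` through `IsJointSpectralMeasure.inner_transfer_translate`; then
`contractionFamily` at `(Ψ_F^{k}, Ψ_G^{k'})` is read back as Schwinger functions with label string
`rev k ++ k'` (`translate_fieldVec`, `transfer_fieldVec`, `inner_fieldVec_fieldVec`), and the bound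
`‖Φ‖ ≤ ‖Ψ_F‖‖Ψ_G‖` squares to `‖𝔖_{2n}^{rev k ++ k}(ΘF*⊗F)‖ ‖𝔖_{2m}^{rev k' ++ k'}(ΘG*⊗G)‖`.
The module imports NO route file (all three statements inline, verbatim the route decls' bodies), so
the gate can link it as the glue of `route edit --split LabelledPlanarSpectralCone` (`--glue-by`).
Strategist's file (planner-cstrat-stmt-QuantumFields-9910-r1-0). [folklore]
-/

noncomputable section

namespace Summit.QuantumFields.QCD.Theorems.LabelledPlanarSpectralConeSplit

open MeasureTheory
open scoped InnerProductSpace SchwartzMap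
open Literature.MathematicalPhysics.QuantumLattice Literature.MathematicalPhysics.AQFT
  Literature.MathematicalPhysics.QuantumFieldTheory
open Summit.QuantumFields.YangMills.Cruxes.PlanarSpectralCone.PositivityDiscToOperatorCone
open Summit.QuantumFields.YangMills.Cruxes.PlanarSpectralCone.TwoMirrorLightconeSlots


/-- The pull-back of a labelled family by the identity frame is the family itself. [folklore] -/
theorem pullback_refl_labelled {ι : Type} (S : LabelledSchwingerFamily ι (EuclideanSpace ℝ (Fin 4))) :
    (fun n (k : Fin n → ι) => (S n k).comp (linActMulti (LinearIsometryEquiv.refl ℝ (EuclideanSpace ℝ (Fin 4))))) = S := by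
  funext n k
  refine ContinuousLinearMap.ext fun F => ?_
  have hF : linActMulti (LinearIsometryEquiv.refl ℝ (EuclideanSpace ℝ (Fin 4))) F = F := SchwartzMap.ext fun _ => rfl
  rw [ContinuousLinearMap.comp_apply, hF]

/-- **The `e₀`-frame OS reconstruction of a labelled family exists under the crux hypotheses**: E2 is
the eight-frame hypothesis at `R = 1` (`a = 1`, `b = 0`), translation invariance on `⁰𝒮` is the crux
hypothesis. [folklore] -/
theorem osReconstruction_e0_labelled {ι : Type} (S : LabelledSchwingerFamily ι (EuclideanSpace ℝ (Fin 4)))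
    (htr : ∀ (n : ℕ) (k : Fin n → ι) (a : (EuclideanSpace ℝ (Fin 4))) (F : 𝓢((Fin n → (EuclideanSpace ℝ (Fin 4))), ℂ)), IsOffDiagonal F →
      S n k (translateMulti a F) = S n k F)
    (hRP : ∀ (R : (EuclideanSpace ℝ (Fin 4)) ≃ₗᵢ[ℝ] (EuclideanSpace ℝ (Fin 4))) (a b : ℝ), a ^ 2 + b ^ 2 = 1 → (a = 0 ∨ b = 0 ∨ a ^ 2 = b ^ 2) →
      R (EuclideanSpace.single 0 1) = a • EuclideanSpace.single 0 1 + b • EuclideanSpace.single 1 1 →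
        LabelledSchwingerFamily.IsReflectionPositive
          (fun n (k : Fin n → ι) => (S n k).comp (linActMulti R))) :
    OSReconstructionNoE1 S := by
  refine ⟨?_, fun n k a F hF => htr n k a F hF⟩
  have h1 := hRP (LinearIsometryEquiv.refl ℝ (EuclideanSpace ℝ (Fin 4))) 1 0 (by norm_num) (Or.inr (Or.inl rfl)) (by simp)
  rwa [pullback_refl_labelled] at h1


/-- `⟪b e₁, p⟫ = b p₁` — matches the Fourier phase of `IsJointSpectralMeasure` at `a = b e₁` with the
integrand of the lever. [folklore] -/
theorem inner_single_one' (b : ℝ) (p : (EuclideanSpace ℝ (Fin 4))) :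
    inner ℝ (EuclideanSpace.single (1 : Fin 4) b) p = b * p 1 := by
  simp [EuclideanSpace.inner_single_left]

/-- **THE SPLIT**: `LabelledConeDiscSections → LabelledConeChainDensity → LabelledPlanarSpectralCone`
(the three statements inline, verbatim the bodies of the route decls of
`Summits/QuantumFields/QCD/Theses/TransparentRPWall.lean`). [folklore] -/
theorem LabelledPlanarSpectralCone_of_subs :
    (open Literature.MathematicalPhysics.QuantumLattice Literature.MathematicalPhysics.AQFT Literature.MathematicalPhysics.QuantumFieldTheory in let E := EuclideanSpace ℝ (Fin 4); ∀ (ι : Type) (S : LabelledSchwingerFamily ι E), (∀ (n : ℕ) (k : Fin n → ι) (a : E) (F : SchwartzMap (Fin n → E) ℂ), IsOffDiagonal F → S n k (translateMulti a F) = S n k F) → (∀ (R : E ≃ₗᵢ[ℝ] E) (a b : ℝ), a ^ 2 + b ^ 2 = 1 → (a = 0 ∨ b = 0 ∨ a ^ 2 = b ^ 2) → R (EuclideanSpace.single 0 1) = a • EuclideanSpace.single 0 1 + b • EuclideanSpace.single 1 1 → LabelledSchwingerFamily.IsReflectionPositive (fun n (k : Fin n → ι) => (S n k).comp (linActMulti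 R))) → ∀ (h : OSReconstructionNoE1 S) (m : ℕ) (k : Fin m → ι) (G : SchwartzMap (Fin m → E) ℂ) (hG : IsTimeOrdered G), tsupport (G : (Fin m → E) → ℂ) ⊆ {x | (∀ i, |x i 1| < x i 0) ∧ ∀ i j, i < j → |x j 1 - x i 1| < x j 0 - x i 0} → ∃ c M : ℝ, 0 ≤ c ∧ ∀ t : ℝ, c < t → ∃ f : ℂ → ℂ, DifferentiableOn ℂ f (Metric.ball 0 (t - c)) ∧ (∀ z ∈ Metric.ball (0 : ℂ) (t - c), ‖f z‖ ≤ M) ∧ ∀ b : ℝ, |b| < t - c → f b = inner ℂ (h.fieldVec m k G hG) (h.transfer t (h.translate (EuclideanSpace.single 1 b) (h.fieldVec m k G hG)))) →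
    (open Literature.MathematicalPhysics.QuantumLattice Literature.MathematicalPhysics.AQFT Literature.MathematicalPhysics.QuantumFieldTheory in let E := EuclideanSpace ℝ (Fin 4); ∀ (ι : Type) (S : LabelledSchwingerFamily ι E) (h : OSReconstructionNoE1 S), Dense ((Submodule.span ℂ {ψ : h.Hilbert | ∃ (m : ℕ) (k : Fin m → ι) (G : SchwartzMap (Fin m → E) ℂ) (hG : IsTimeOrdered G), tsupport (G : (Fin m → E) → ℂ) ⊆ {x | (∀ i, |x i 1| < x i 0) ∧ ∀ i j, i < j → |x j 1 - x i 1| < x j 0 - x i 0} ∧ ψ = h.fieldVec m k G hG} : Submodule ℂ h.Hilbert) : Set h.Hilbert)) →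
    (open Literature.MathematicalPhysics.QuantumLattice Literature.MathematicalPhysics.AQFT Literature.MathematicalPhysics.QuantumFieldTheory in let E := EuclideanSpace ℝ (Fin 4); ∀ (ι : Type) (S : LabelledSchwingerFamily ι E), S.HasLinearGrowth → S.IsSymmetric → (∀ (n : ℕ) (k : Fin n → ι) (a : E) (F : SchwartzMap (Fin n → E) ℂ), IsOffDiagonal F → S n k (translateMulti a F) = S n k F) → (∀ (R : E ≃ₗᵢ[ℝ] E) (a b : ℝ), a ^ 2 + b ^ 2 = 1 → (a = 0 ∨ b = 0 ∨ a ^ 2 = b ^ 2) → R (EuclideanSpace.single 0 1) = a • EuclideanSpace.single 0 1 + b • EuclideanSpace.single 1 1 → LabelledSchwingerFamily.IsReflectionPositive (fun n (k : Fin n → ι) => (S n k).comp (linActMulti R))) → (∀ (n m : ℕ) (k : Fin n → ι) (k' : Fin m → ι) (F : SchwartzMap (Fin n → E) ℂ) (G : SchwartzMap (Fin m → E) ℂ), IsTimeOrdered F → IsTimeOrdered G → ∃ Φ : ℂ × ℂ → ℂ, DifferentiableOn ℂ Φ {w : ℂ × ℂ | |w.2.im| < w.1.re} ∧ (∀ (t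 b : ℝ), 0 < t → ∀ H : SchwartzMap (Fin (n + m) → E) ℂ, IsAppendTensorOf H (osAdjoint F) (translateMulti (t • EuclideanSpace.single 0 1 + b • EuclideanSpace.single 1 1) G) → Φ ((t : ℂ), (b : ℂ)) = S (n + m) (Fin.append (k ∘ Fin.rev) k') H) ∧ (∀ w ∈ {w : ℂ × ℂ | |w.2.im| < w.1.re}, ∀ (HF : SchwartzMap (Fin (n + n) → E) ℂ) (HG : SchwartzMap (Fin (m + m) → E) ℂ), IsAppendTensorOf HF (osAdjoint F) F → IsAppendTensorOf HG (osAdjoint G) G → ‖Φ w‖ ^ 2 ≤ ‖S (n + n) (Fin.append (k ∘ Fin.rev) k) HF‖ * ‖S (m + m) (Fin.append (k' ∘ Fin.rev) k') HG‖))) := by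
  intro hX1 hX2 E ι S hlg hsym htr hRP n m k k' F G hF hG
  -- E0' (`hlg`) and E3 (`hsym`) are idle (as in the one-species line; cdisprove `sharpened_implies_crux`)
  have _ := hlg
  have _ := hsym
  -- (1) the `e₀`-frame OS reconstruction
  have h : OSReconstructionNoE1 S := osReconstruction_e0_labelled S htr hRP
  -- (2) the operator cone `C⁺`: every joint spectral measure of every vector is carried by `{p₀ ≥ |p₁|}`
  have hcone : ∀ (ψ : h.Hilbert) (μ : Measure (EuclideanSpace ℝ (Fin 4))), h.IsJointSpectralMeasure ψ μ →
      μ {p | p 0 < |p 1|} = 0 := by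
    intro ψ μ hμ
    refine stub_linearity h (measurableSet_lt (by fun_prop) (by fun_prop)) (hX2 ι S h) ?_ ψ μ hμ
    rintro ψ' ⟨m', κ, G', hG', hC, rfl⟩ μ' hμ'
    obtain ⟨c, M, hc, hdisc⟩ := hX1 ι S htr hRP h m' κ G' hG' hC
    haveI := hμ'.isFiniteMeasure
    refine stub_cone_of_discSections μ' hμ'.energy_nonneg c M hc fun t ht => ?_
    obtain ⟨f, hf, hfM, hfb⟩ := hdisc t ht
    refine ⟨f, hf, hfM, fun b hb => ?_⟩
    rw [hfb b hb, hμ'.inner_transfer_translate t (hc.trans_lt ht).le (EuclideanSpace.single 1 b)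
      (by simp)]
    simp_rw [inner_single_one']
  -- (3) transfer `C⁺ ⇒ C`: the contraction family of `(Ψ_F^{k}, Ψ_G^{k'})`, read back as Schwinger functions
  obtain ⟨Φ, hΦd, hΦr, hΦb⟩ := Contraction.contractionFamily h hcone
    (h.fieldVec n k F hF) (h.fieldVec m k' G hG)
  refine ⟨Φ, hΦd, ?_, ?_⟩
  · intro t b ht H hH
    rw [hΦr t b ht, OSReconstructionNoE1.translate_fieldVec,
      OSReconstructionNoE1.transfer_fieldVec _ ht.le]
    have hH' : IsAppendTensorOf H (osAdjoint F) (translateMulti (SchwingerFamily.timeVec t)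
        (translateMulti (spatialPart 0 (b • (EuclideanSpace.single 1 1 : (EuclideanSpace ℝ (Fin 4))))) G)) := by
      rw [DiscSections.translateMulti_time_space]; exact hH
    rw [h.inner_fieldVec_fieldVec k k' hF _ hH']
  · intro w hw HF HG hHF hHG
    have hb := hΦb w hw
    have hsq : ∀ {j : ℕ} (κ : Fin j → ι) (A : 𝓢((Fin j → (EuclideanSpace ℝ (Fin 4))), ℂ)) (hA : IsTimeOrdered A)
        (HA : 𝓢((Fin (j + j) → (EuclideanSpace ℝ (Fin 4))), ℂ)),
        IsAppendTensorOf HA (osAdjoint A) A →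
          ‖S (j + j) (Fin.append (κ ∘ Fin.rev) κ) HA‖ = ‖h.fieldVec j κ A hA‖ ^ 2 := by
      intro j κ A hA HA hHA
      have e := h.inner_fieldVec_fieldVec κ κ hA hA hHA
      rw [← e, inner_self_eq_norm_sq_to_K, norm_pow, RCLike.norm_ofReal, abs_norm]
    rw [hsq k F hF HF hHF, hsq k' G hG HG hHG, ← mul_pow]
    exact pow_le_pow_left₀ (norm_nonneg _) hb 2

end Summit.QuantumFields.QCD.Theorems.LabelledPlanarSpectralConeSplit

end
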